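import Mathlib.Tactic.NoncommRing
import Literature.MathematicalPhysics.QuantumLattice.HeisenbergModel
import Literature.MathematicalPhysics.QuantumLattice.ProductOperators
import Literature.MathematicalPhysics.QuantumLattice.SpinOperatorsProofs
import HarnessLib

/-!
# Discharge of `commute_heisenberg_globalRotation` (and `commute_heisenberg_totalSpin`)

Sibling proof file of `Literature/MathematicalPhysics/QuantumLattice/HeisenbergModel.lean`
(no statement of that file is changed; this file only proves). We prove the `SU(2)` invariance
of the Heisenberg Hamiltonian `H = J Σ_{{x,y} ∈ E(G)} 𝐒_x · 𝐒_y` in both forms recorded there as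
named facts:

* `commute_heisenberg_totalSpin_holds n G : commute_heisenberg_totalSpin n G`, i.e.
  `[H, Ŝ^α_tot] = 0` for `α = 1, 2, 3` (Tasaki (2020) §2.5, eq. (2.5.2); the computation uses
  only `[Ŝ^α, Ŝ^β] = i ε_{αβγ} Ŝ^γ` at one site (Tasaki (2020) §2.1, eq. (2.1.1)) and
  commutativity at distinct sites (§2.2, eq. (2.2.6)): `[Ŝ^α_x Ŝ^α_y, Ŝ^β_tot] =
  Ŝ^α_x ([Ŝ^α, Ŝ^β])_y + ([Ŝ^α, Ŝ^β])_x Ŝ^α_y`, and the sum over `α` of the right-hand side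
  telescopes to `0`, for `x = y` as well as for `x ≠ y`);
* `commute_heisenberg_globalRotation_holds n G : commute_heisenberg_globalRotation n G`, i.e.
  `[H, Û(θ)] = 0` for the global rotation `Û(θ) = ⨂_x exp(-iθ·𝐒_x)` (Tasaki (2020) §2.2,
  eq. (2.2.12), and §2.5, eq. (2.5.2)). This is reduced to the infinitesimal form by the identity
  `⨂_x exp(-iθ·𝐒_x) = exp(-iθ·𝐒_tot)` (Tasaki (2020) §2.2, eq. (2.2.12)),
  `globalRotation_eq_exp_totalSpin`, proved from `exp (A + B) = exp A exp B` for commuting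
  `A, B` (Mathlib `Matrix.exp_add_of_commute`), the fact that `a ↦ onSite x a` is a continuous
  algebra homomorphism (so it commutes with `exp`, Mathlib `NormedSpace.map_exp`), and the
  product structure `productOp_mul` of `ProductOperators.lean`; then anything commuting with the
  three components of the total spin commutes with `exp(-iθ·𝐒_tot)` (Mathlib `Commute.exp_right`),
  `commute_globalRotation_of_commute_totalSpin`.

Ingredients from the tree: `spin_commutation_holds` (`SpinOperatorsProofs`), `onSite_mul`,
`onSite_add'`, `onSite_smul'`, `onSite_one'`, `onSite_mul_onSite_comm`, `onSite_eq_productOp`,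
`productOp_mul`, `globalRotation_eq_productOp` (`ProductOperators`).

## Sources

H. Tasaki, *Physics and Mathematics of Quantum Many-Body Systems* (Springer, 2020), §2.1
(eq. (2.1.1)), §2.2 (eqs. (2.2.5), (2.2.6), (2.2.11), (2.2.12)), §2.5 (eq. (2.5.2)). All
statements are finite-dimensional matrix algebra. [folklore]
-/

noncomputable section

open Matrix Complex

namespace Literature.MathematicalPhysics.QuantumLattice

section QLattice

variable {Λ : Type*} [Fintype Λ] [DecidableEq Λ] {q : ℕ}

/-! ### More algebra of single-site operators -/

/-- `onSite x 0 = 0`. [folklore] -/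
@[simp] theorem onSite_zero (x : Λ) : (onSite x (0 : Matrix (Fin q) (Fin q) ℂ) : Op Λ q) = 0 := by
  ext σ τ
  simp only [onSite_apply, Matrix.zero_apply]
  split_ifs <;> rfl

/-- `a ↦ onSite x a` commutes with finite sums. [folklore] -/
theorem onSite_sum {ι : Type*} (x : Λ) (s : Finset ι) (f : ι → Matrix (Fin q) (Fin q) ℂ) :
    (onSite x (∑ i ∈ s, f i) : Op Λ q) = ∑ i ∈ s, onSite x (f i) :=
  map_sum (AddMonoidHom.mk' (fun a => (onSite x a : Op Λ q)) (onSite_add' x)) f s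

/-- **`a ↦ onSite x a` commutes with the matrix exponential**: `𝟙 ⊗ e^{a} ⊗ 𝟙 = e^{𝟙 ⊗ a ⊗ 𝟙}`
(`a ↦ onSite x a` is a continuous algebra homomorphism of finite-dimensional algebras; Mathlib's
`NormedSpace.map_exp` in the sup operator norm, the exponential being norm independent).
Tasaki (2020) §2.2, eq. (2.2.12). [folklore] -/
theorem onSite_exp (x : Λ) (a : Matrix (Fin q) (Fin q) ℂ) :
    (onSite x (NormedSpace.exp a) : Op Λ q) = NormedSpace.exp (onSite x a : Op Λ q) := by
  let f : Matrix (Fin q) (Fin q) ℂ →ₐ[ℂ] Op Λ q :=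
    AlgHom.ofLinearMap
      { toFun := fun a => onSite x a
        map_add' := onSite_add' x
        map_smul' := onSite_smul' x }
      (onSite_one' x) (fun a b => (onSite_mul x a b).symm)
  have hf : Continuous f := f.toLinearMap.continuous_of_finiteDimensional
  open scoped Matrix.Norms.Operator in exact NormedSpace.map_exp f hf a

/-- Single-site operators at distinct sites commute (`Commute` form of `onSite_mul_onSite_comm`).
Tasaki (2020) §2.2, eq. (2.2.6). [folklore] -/
theorem commute_onSite_onSite {x y : Λ} (hxy : x ≠ y) (a b : Matrix (Fin q) (Fin q) ℂ) :
    Commute (onSite x a : Op Λ q) (onSite y b) :=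
  onSite_mul_onSite_comm hxy a b

/-! ### `⨂_x exp(a) = exp(Σ_x onSite x a)` -/

/-- **Exponential of a sum of copies of one single-site operator**:
`exp(Σ_{x ∈ s} 𝟙 ⊗ a_x ⊗ 𝟙) = ⨂_{x ∈ s} e^{a}` (the summands commute pairwise, and each
exponential is computed on site). Tasaki (2020) §2.2, eq. (2.2.12). [folklore] -/
theorem exp_sum_onSite (s : Finset Λ) (a : Matrix (Fin q) (Fin q) ℂ) :
    NormedSpace.exp (∑ x ∈ s, (onSite x a : Op Λ q)) =
      productOp fun x => if x ∈ s then NormedSpace.exp a else 1 := by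
  induction s using Finset.induction_on with
  | empty => simp
  | insert x s hx ih =>
    have hc : Commute (onSite x a : Op Λ q) (∑ y ∈ s, onSite y a) :=
      Commute.sum_right _ _ _ fun y hy => commute_onSite_onSite (fun h => hx (by rw [h]; exact hy)) a a
    rw [Finset.sum_insert hx, Matrix.exp_add_of_commute _ _ hc, ih, ← onSite_exp,
      onSite_eq_productOp, productOp_mul]
    congr 1
    funext z
    by_cases hz : z = x
    · subst hz
      simp [hx]
    · simp [hz]

/-- **The global rotation is the exponential of the total spin**:
`⨂_x exp(-iθ·𝐒_x) = exp(Σ_x 𝟙 ⊗ (-iθ·𝐒) ⊗ 𝟙)`. Tasaki (2020) §2.2, eq. (2.2.12). [folklore] -/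
theorem globalRotation_eq_exp_sum_onSite (n : ℕ) (θ : Fin 3 → ℝ) :
    globalRotation (Λ := Λ) n θ =
      NormedSpace.exp (∑ x : Λ,
        (onSite x ((-I) • ∑ α : Fin 3, (θ α : ℂ) • spinVec n α) : Op Λ (n + 1))) := by
  rw [exp_sum_onSite, globalRotation_eq_productOp]
  simp only [Finset.mem_univ, if_true]
  rfl

/-- `Σ_x 𝟙 ⊗ (-iθ·𝐒) ⊗ 𝟙 = -i Σ_α θ_α Ŝ^α_tot`. Tasaki (2020) §2.2, eq. (2.2.11). [folklore] -/
theorem sum_onSite_rotationGenerator (n : ℕ) (θ : Fin 3 → ℝ) :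
    ∑ x : Λ, (onSite x ((-I) • ∑ α : Fin 3, (θ α : ℂ) • spinVec n α) : Op Λ (n + 1)) =
      (-I) • ∑ α : Fin 3, (θ α : ℂ) • totalSpin (Λ := Λ) n α := by
  simp only [onSite_smul', onSite_sum, totalSpin, siteSpin, Finset.smul_sum]
  rw [Finset.sum_comm]

/-- **`Û(θ) = exp(-iθ·𝐒_tot)`**: the global rotation `⨂_x exp(-iθ·𝐒_x)` is the exponential of
`-i Σ_α θ_α Ŝ^α_tot`. Tasaki (2020) §2.2, eq. (2.2.12). [folklore] -/
theorem globalRotation_eq_exp_totalSpin (n : ℕ) (θ : Fin 3 → ℝ) :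
    globalRotation (Λ := Λ) n θ =
      NormedSpace.exp ((-I) • ∑ α : Fin 3, (θ α : ℂ) • totalSpin (Λ := Λ) n α) := by
  rw [globalRotation_eq_exp_sum_onSite, sum_onSite_rotationGenerator]

/-- **Rotation invariance from infinitesimal invariance**: an observable commuting with the three
components of the total spin commutes with every global rotation `Û(θ)`.
Tasaki (2020) §2.2, eq. (2.2.12); §2.5, eq. (2.5.2). [folklore] -/
theorem commute_globalRotation_of_commute_totalSpin {n : ℕ} {A : Op Λ (n + 1)}
    (h : ∀ α : Fin 3, Commute A (totalSpin n α)) (θ : Fin 3 → ℝ) :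
    Commute A (globalRotation n θ) := by
  rw [globalRotation_eq_exp_totalSpin]
  exact (Commute.smul_right (Commute.sum_right _ _ _ fun α _ => (h α).smul_right _) _).exp_right

/-! ### `[𝐒_x · 𝐒_y, Ŝ^β_tot] = 0` -/

/-- `Ŝ^a_x Ŝ^b_tot = Ŝ^b_tot Ŝ^a_x + ([Ŝ^a, Ŝ^b])_x`: only the site `x` term of the total spin
fails to commute with `Ŝ^a_x`. Tasaki (2020) §2.2, eqs. (2.2.6), (2.2.11). [folklore] -/
theorem siteSpin_mul_totalSpin (n : ℕ) (x : Λ) (a b : Fin 3) :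
    (siteSpin n x a * totalSpin n b : Op Λ (n + 1)) =
      totalSpin n b * siteSpin n x a + onSite x ⁅spinVec n a, spinVec n b⁆ := by
  have key : ∀ z : Λ, (siteSpin n x a * siteSpin n z b : Op Λ (n + 1)) =
      siteSpin n z b * siteSpin n x a +
        if z = x then onSite x ⁅spinVec n a, spinVec n b⁆ else 0 := by
    intro z
    by_cases hz : z = x
    · subst hz
      rw [if_pos rfl]
      simp only [siteSpin]
      rw [onSite_mul, onSite_mul, ← onSite_add', Ring.lie_def]
      congr 1
      abel
    · rw [if_neg hz, add_zero]
      exact onSite_mul_onSite_comm (Ne.symm hz) _ _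
  calc (siteSpin n x a * totalSpin n b : Op Λ (n + 1))
      = ∑ z, siteSpin n x a * siteSpin n z b := by rw [totalSpin, Finset.mul_sum]
    _ = ∑ z, (siteSpin n z b * siteSpin n x a +
          if z = x then onSite x ⁅spinVec n a, spinVec n b⁆ else 0) :=
        Finset.sum_congr rfl fun z _ => key z
    _ = totalSpin n b * siteSpin n x a + onSite x ⁅spinVec n a, spinVec n b⁆ := by
        rw [Finset.sum_add_distrib, Finset.sum_ite_eq', if_pos (Finset.mem_univ x), totalSpin,
          Finset.sum_mul]

/-- The commutator form of `siteSpin_mul_totalSpin`: `[Ŝ^a_x, Ŝ^b_tot] = ([Ŝ^a, Ŝ^b])_x`.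
Tasaki (2020) §2.2, eqs. (2.2.6), (2.2.11). [folklore] -/
theorem siteSpin_mul_totalSpin_sub (n : ℕ) (x : Λ) (a b : Fin 3) :
    (siteSpin n x a * totalSpin n b - totalSpin n b * siteSpin n x a : Op Λ (n + 1)) =
      onSite x ⁅spinVec n a, spinVec n b⁆ := by
  rw [siteSpin_mul_totalSpin, add_sub_cancel_left]

/-- A sum over `Fin 3` started at `b`: `Σ_α f α = f b + f (b+1) + f (b+2)`. [folklore] -/
theorem sum_univ_fin_three_shift {M : Type*} [AddCommMonoid M] (f : Fin 3 → M) (b : Fin 3) :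
    ∑ α, f α = f b + f (b + 1) + f (b + 2) := by
  rw [← Equiv.sum_comp (Equiv.addLeft b) f, Fin.sum_univ_three]
  simp only [Equiv.coe_addLeft, add_zero]

/-- **The telescoping behind `SU(2)` invariance** (abstract form): if `T` acts on two commuting
triples `X, Y` as the generator `Ŝ^β` acts on `(Ŝ^β, Ŝ^{β+1}, Ŝ^{β+2})`, namely
`[X₀, T] = 0`, `[X₁, T] = -i X₂`, `[X₂, T] = i X₁` (and likewise for `Y`), then
`X₀Y₀ + X₁Y₁ + X₂Y₂` commutes with `T`. Tasaki (2020) §2.5, eq. (2.5.2). [folklore] -/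
theorem commute_sum_mul_of_lie {R : Type*} [Ring R] [Algebra ℂ R] {T X₀ X₁ X₂ Y₀ Y₁ Y₂ : R}
    (hX₀ : X₀ * T - T * X₀ = 0) (hX₁ : X₁ * T - T * X₁ = -(I • X₂))
    (hX₂ : X₂ * T - T * X₂ = I • X₁)
    (hY₀ : Y₀ * T - T * Y₀ = 0) (hY₁ : Y₁ * T - T * Y₁ = -(I • Y₂))
    (hY₂ : Y₂ * T - T * Y₂ = I • Y₁) :
    Commute (X₀ * Y₀ + X₁ * Y₁ + X₂ * Y₂) T := by
  change (X₀ * Y₀ + X₁ * Y₁ + X₂ * Y₂) * T = T * (X₀ * Y₀ + X₁ * Y₁ + X₂ * Y₂)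
  rw [← sub_eq_zero]
  have e : (X₀ * Y₀ + X₁ * Y₁ + X₂ * Y₂) * T - T * (X₀ * Y₀ + X₁ * Y₁ + X₂ * Y₂) =
      X₀ * (Y₀ * T - T * Y₀) + (X₀ * T - T * X₀) * Y₀ +
        (X₁ * (Y₁ * T - T * Y₁) + (X₁ * T - T * X₁) * Y₁) +
        (X₂ * (Y₂ * T - T * Y₂) + (X₂ * T - T * X₂) * Y₂) := by
    noncomm_ring
  rw [e, hX₀, hX₁, hX₂, hY₀, hY₁, hY₂]
  simp only [mul_zero, zero_mul, zero_add, mul_neg, neg_mul, mul_smul_comm, smul_mul_assoc]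
  abel

/-- **`[Σ_α Ŝ^α_x Ŝ^α_y, Ŝ^β_tot] = 0`** for all sites `x, y` (equal or not) and every `β`.
Tasaki (2020) §2.5, eq. (2.5.2). [folklore] -/
theorem commute_sum_siteSpin_mul_siteSpin_totalSpin (n : ℕ) (x y : Λ) (b : Fin 3) :
    Commute (∑ α : Fin 3, (siteSpin n x α * siteSpin n y α : Op Λ (n + 1))) (totalSpin n b) := by
  have e3 : ∀ c : Fin 3, c + 2 + 1 = c := by decide
  have e4 : ∀ c : Fin 3, c + 2 + 2 = c + 1 := by decide
  have h0 : ∀ z : Λ,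
      (siteSpin n z b * totalSpin n b - totalSpin n b * siteSpin n z b : Op Λ (n + 1)) = 0 := by
    intro z
    rw [siteSpin_mul_totalSpin_sub, Ring.lie_def, sub_self, onSite_zero]
  have h1 : ∀ z : Λ,
      (siteSpin n z (b + 1) * totalSpin n b - totalSpin n b * siteSpin n z (b + 1) :
        Op Λ (n + 1)) = -(I • siteSpin n z (b + 2)) := by
    intro z
    have hc : ⁅spinVec n (b + 1), spinVec n b⁆ = -(I • spinVec n (b + 2)) := by
      rw [← spin_commutation_holds n b, Ring.lie_def, Ring.lie_def, neg_sub]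
    rw [siteSpin_mul_totalSpin_sub, hc, onSite_neg', onSite_smul']
    rfl
  have h2 : ∀ z : Λ,
      (siteSpin n z (b + 2) * totalSpin n b - totalSpin n b * siteSpin n z (b + 2) :
        Op Λ (n + 1)) = I • siteSpin n z (b + 1) := by
    intro z
    have hc : ⁅spinVec n (b + 2), spinVec n (b + 2 + 1)⁆ = I • spinVec n (b + 2 + 2) :=
      spin_commutation_holds n (b + 2)
    rw [e3, e4] at hc
    rw [siteSpin_mul_totalSpin_sub, hc, onSite_smul']
    rfl
  rw [sum_univ_fin_three_shift _ b]
  exact commute_sum_mul_of_lie (h0 x) (h1 x) (h2 x) (h0 y) (h1 y) (h2 y)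

/-- **`[𝐒_x · 𝐒_y, Ŝ^β_tot] = 0`**: the Heisenberg exchange operator is `SU(2)` invariant.
Tasaki (2020) §2.5, eq. (2.5.2). [folklore] -/
theorem commute_spinDot_totalSpin (n : ℕ) (x y : Λ) (b : Fin 3) :
    Commute (spinDot n x y) (totalSpin n b) := by
  have h : spinDot n x y = (1 / 2 : ℂ) • (∑ α : Fin 3, (siteSpin n x α * siteSpin n y α :
      Op Λ (n + 1)) + ∑ α : Fin 3, siteSpin n y α * siteSpin n x α) := by
    simp only [spinDot, spinBond, ← Finset.smul_sum, Finset.sum_add_distrib]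
  rw [h]
  exact ((commute_sum_siteSpin_mul_siteSpin_totalSpin n x y b).add_left
    (commute_sum_siteSpin_mul_siteSpin_totalSpin n y x b)).smul_left _

/-- `[𝐒_x · 𝐒_y, Ŝ^β_tot] = 0` on unordered pairs. Tasaki (2020) §2.5, eq. (2.5.2). [folklore] -/
theorem commute_spinDotSym_totalSpin (n : ℕ) (e : Sym2 Λ) (b : Fin 3) :
    Commute (spinDotSym n e) (totalSpin n b) := by
  induction e using Sym2.ind with
  | h x y => exact commute_spinDot_totalSpin n x y b

/-! ### The discharges -/

section Graph

variable (n : ℕ) (G : SimpleGraph Λ) [DecidableRel G.Adj]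

/-- **`[H, Ŝ^α_tot] = 0`** for the Heisenberg Hamiltonian on any finite graph and any coupling.
Tasaki (2020) §2.5, eq. (2.5.2). [folklore] -/
theorem commute_heisenbergHamiltonian_totalSpin (J : ℝ) (b : Fin 3) :
    Commute (heisenbergHamiltonian n G J) (totalSpin n b) := by
  unfold heisenbergHamiltonian
  exact (Commute.sum_left _ _ _ fun e _ => commute_spinDotSym_totalSpin n e b).smul_left _

/-- **Discharge of `commute_heisenberg_totalSpin`** (`SU(2)` invariance, infinitesimal form).
Tasaki (2020) §2.5, eq. (2.5.2). [folklore] -/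
theorem commute_heisenberg_totalSpin_holds : commute_heisenberg_totalSpin n G :=
  fun J α => commute_heisenbergHamiltonian_totalSpin n G J α

/-- **`[H, Û(θ)] = 0`**: the Heisenberg Hamiltonian commutes with the global rotations
`Û(θ) = ⨂_x exp(-iθ·𝐒_x) = exp(-iθ·𝐒_tot)`. Tasaki (2020) §2.5, eq. (2.5.2), with §2.2,
eq. (2.2.12). [folklore] -/
theorem commute_heisenbergHamiltonian_globalRotation (J : ℝ) (θ : Fin 3 → ℝ) :
    Commute (heisenbergHamiltonian n G J) (globalRotation n θ) :=
  commute_globalRotation_of_commute_totalSpin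
    (fun α => commute_heisenbergHamiltonian_totalSpin n G J α) θ

/-- **Discharge of `commute_heisenberg_globalRotation`** (`SU(2)` invariance, global form).
Tasaki (2020) §2.5, eq. (2.5.2); §2.2, eq. (2.2.12). [folklore] -/
theorem commute_heisenberg_globalRotation_holds : commute_heisenberg_globalRotation n G :=
  fun J θ => commute_heisenbergHamiltonian_globalRotation n G J θ

end Graph

end QLattice

end Literature.MathematicalPhysics.QuantumLattice
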